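import Literature.Geometry.Riemannian.MetricFlowHeatFlow
import Literature.Geometry.Riemannian.MetricFlowPhiLipschitz
import HarnessLib

/-!
# Gradient estimates for heat flows on a metric flow: `Φ ∘ (Lipschitz)` data and the
# preservation of Lipschitz bounds (Bamler 2023, §3.2, Proposition "gradient-type estimates")

R. Bamler, *Compactness theory of the space of super Ricci flows*, Invent. Math. 233 (2023), §3.2,
the Proposition headed *"We also have the following gradient-type estimates"* (the third
Proposition of §3.2): if `(u_t)_{t ∈ I'}` is a heat flow on a metric flow `𝒳` and `s < t`,
`T ≥ 0`, then
(a) *"Assume that `T > 0` and that `u_s = a(Φ ∘ f_s)` for some `a ∈ ℝ` and some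
`T^{-1/2}`-Lipschitz function `f_s : 𝒳_s → ℝ`, or that `T = 0` and `0 ≤ u_s ≤ 1`. Then
`u_t = a(Φ ∘ f_t)` for some `(t − s + T)^{-1/2}`-Lipschitz function `f_t : 𝒳_t → ℝ`"*
(proof: *"follows from Definition 3.2(6)"*), and
(b) *"If `u_s` is `L`-Lipschitz for some `L ≥ 0`, then so is `u_t`"* (proof: *"can be reduced to
the case in which `u_s` is bounded. Then (b) follows by applying (a) to `½ + εu` and letting
`ε → 0`"*).

For the heat flow `heatFlowOf s ũ` of a bounded measurable datum (`MetricFlowHeatFlow.lean`) we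
prove:

* `heatFlowOf_eq_Phi_comp_or_const` — (a) with `a = 1`, verbatim from item (6) of
  `MetricFlow` (the tree's item (6) allows the degenerate alternative "`u_t` is constant", which
  the printed statement absorbs for `T > 0` into `Φ ∘ const`);
* `dist_heatFlowOf_le` — the quantitative core of (b): if `ũ` is bounded, measurable and
  `L`-Lipschitz, `L > 0`, then `|u_t x − u_t y| ≤ (L + η) d_t(x, y)` for every `η > 0` (apply (a)
  to `Φ(0) + εũ = Φ ∘ (Φ⁻¹(Φ(0) + εũ))`, whose Lipschitz constant is `ε L` times that of `Φ⁻¹` on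
  `[Φ(0) − δ, Φ(0) + δ]`, which tends to `1/Φ'(0) = √(4π)` as `δ → 0`, while `Φ` is
  `(4π)^{-1/2}`-Lipschitz);
* `lipschitzWith_heatFlowOf` — **(b)**: the heat flow of a bounded measurable `L`-Lipschitz datum
  is `L`-Lipschitz on every later time-slice;
* `IsHeatFlow.lipschitzWith` — the same for an arbitrary heat flow over `I'` whose value at a
  time `s ∈ I'` is bounded, measurable and `L`-Lipschitz.

Everything is proved; no definitions, no named facts. What is NOT here: the reduction of (b)
to bounded data (truncation), and the factor `a` in (a).

## References

* R. H. Bamler, *Compactness theory of the space of super Ricci flows*, Invent. Math. 233 (2023),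
  §3.1 Def. 3.2 (6), §3.2 (gradient-type estimates for heat flows). [Bamler2023]
-/

noncomputable section

open Set MeasureTheory Filter Metric
open scoped Topology NNReal

namespace Literature.Geometry.Riemannian

namespace MetricFlow

universe u

variable {I : Set ℝ} (𝒳 : MetricFlow.{u} I)

/-- **Gradient estimate for heat flows of `Φ ∘ (Lipschitz)` data** (Bamler 2023, §3.2,
gradient-type estimates (a), with `a = 1`): for `s < t` in `I`, `T ≥ 0` and a measurable
`ũ : 𝒳_s → [0, 1]` which, if `T > 0`, is `Φ ∘ f` for a `T^{-1/2}`-Lipschitz `f`, the heat flow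
`u_t = ∫ ũ dν_{·;s}` on `𝒳_t` is constant or of the form `Φ ∘ f'` with `f'`
`(t − s + T)^{-1/2}`-Lipschitz — item (6) of the definition of a metric flow.
[cite: Bamler2023, §3.2, Proposition (gradient-type estimates) (a)] -/
theorem heatFlowOf_eq_Phi_comp_or_const {s t : I} (hst : (s : ℝ) < t) {T : ℝ} (hT : 0 ≤ T)
    {u₀ : 𝒳.Slice s → ℝ} (hm : Measurable u₀) (h01 : ∀ y, u₀ y ∈ Icc (0 : ℝ) 1)
    (hf : 0 < T → ∃ f : 𝒳.Slice s → ℝ,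
      LipschitzWith (Real.toNNReal (1 / Real.sqrt T)) f ∧ u₀ = Phi ∘ f) :
    (∃ c : ℝ, ∀ x : 𝒳.Slice t, 𝒳.heatFlowOf s u₀ t x = c) ∨
      ∃ f' : 𝒳.Slice t → ℝ,
        LipschitzWith (Real.toNNReal (1 / Real.sqrt ((t : ℝ) - s + T))) f' ∧
          ∀ x : 𝒳.Slice t, 𝒳.heatFlowOf s u₀ t x = Phi (f' x) :=
  𝒳.gradient_property hst T hT u₀ hm h01 hf

/-- The derivative of `Φ⁻¹` at a point of `(0, 1)`: `(Φ⁻¹)'(c) = √(4π) e^{(Φ⁻¹ c)²/4}`.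
[cite: Bamler2023, §3, (3.1)] -/
theorem hasDerivAt_PhiInv_of_mem {c : ℝ} (hc0 : 0 < c) (hc1 : c < 1) :
    HasDerivAt PhiInv (Real.sqrt (4 * Real.pi) * Real.exp ((PhiInv c) ^ 2 / 4)) c := by
  have h := hasDerivAt_PhiInv (PhiInv c)
  rw [Phi_PhiInv hc0 hc1] at h
  convert h using 1
  rw [mul_inv, inv_inv, ← Real.exp_neg]
  congr 1
  ring

/-- **The quantitative core of the Lipschitz estimate** (Bamler 2023, §3.2, gradient-type
estimates, proof of (b)): if `ũ : 𝒳_s → ℝ` is measurable, bounded and `L`-Lipschitz with `L > 0`,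
then for `s < t` and every `η > 0` the heat flow satisfies
`|u_t(x) − u_t(y)| ≤ (L + η) d_t(x, y)`. Proof as printed: apply (a) to
`Φ(0) + εũ = Φ ∘ f`, `f = Φ⁻¹ ∘ (Φ(0) + εũ)`; for `ε` small the values stay in
`[Φ(0) − δ, Φ(0) + δ] ⊆ (0, 1)`, where `Φ⁻¹` is `(√(4π) + η')`-Lipschitz (mean value theorem,
`(Φ⁻¹)'(Φ(0)) = √(4π)`), so `f` is `T^{-1/2} := (√(4π) + η')εL`-Lipschitz; then
`Φ(0) + εu_t = Φ ∘ f'` with `f'` `T^{-1/2}`-Lipschitz (or `u_t` is constant), and `Φ` is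
`(4π)^{-1/2}`-Lipschitz. [cite: Bamler2023, §3.2, Proposition (gradient-type estimates) (b)] -/
theorem dist_heatFlowOf_le {s t : I} (hst : (s : ℝ) < t) {u₀ : 𝒳.Slice s → ℝ}
    (hm : Measurable u₀) {B : ℝ} (hB : ∀ y, |u₀ y| ≤ B) {L : ℝ} (hL : 0 < L)
    (hlip : ∀ y₁ y₂, dist (u₀ y₁) (u₀ y₂) ≤ L * dist y₁ y₂) {η : ℝ} (hη : 0 < η)
    (x y : 𝒳.Slice t) :
    dist (𝒳.heatFlowOf s u₀ t x) (𝒳.heatFlowOf s u₀ t y) ≤ (L + η) * dist x y := by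
  -- constants: `c₀ = Φ(0)`, `A = √(4π)`, the derivative `g` of `Φ⁻¹`
  set c₀ : ℝ := Phi 0 with hc₀_def
  have hc₀0 : 0 < c₀ := Phi_pos 0
  have hc₀1 : c₀ < 1 := Phi_lt_one 0
  set A : ℝ := Real.sqrt (4 * Real.pi) with hA_def
  have hA : 0 < A := Real.sqrt_pos.2 (by positivity)
  set g : ℝ → ℝ := fun c ↦ A * Real.exp ((PhiInv c) ^ 2 / 4) with hg_def
  have hg_nonneg : ∀ c, 0 ≤ g c := fun c ↦ mul_nonneg hA.le (Real.exp_pos _).le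
  have hPhiInv_c₀ : PhiInv c₀ = 0 := by rw [hc₀_def, PhiInv_Phi]
  have hgc₀ : g c₀ = A := by
    show A * Real.exp ((PhiInv c₀) ^ 2 / 4) = A
    rw [hPhiInv_c₀]
    simp
  have hgcont : ContinuousAt g c₀ := by
    have h1 : ContinuousAt PhiInv c₀ := continuousAt_PhiInv hc₀0 hc₀1
    exact continuousAt_const.mul
      (Real.continuous_exp.continuousAt.comp ((h1.pow 2).div_const 4))
  -- the auxiliary accuracy `η' = ηA/L` and the interval `[c₀ - δ, c₀ + δ] ⊆ (0, 1)`
  set η' : ℝ := η * A / L with hη'_def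
  have hη' : 0 < η' := by positivity
  obtain ⟨δ₁, hδ₁, hδ₁g⟩ := Metric.continuousAt_iff.1 hgcont η' hη'
  set δ : ℝ := min (δ₁ / 2) (min c₀ (1 - c₀) / 2) with hδ_def
  have hδ : 0 < δ := by
    refine lt_min (by linarith) ?_
    have : 0 < min c₀ (1 - c₀) := lt_min hc₀0 (by linarith)
    linarith
  have hδ₁' : δ < δ₁ := lt_of_le_of_lt (min_le_left _ _) (by linarith)
  have hδc₀ : δ < c₀ := by
    have h1 : δ ≤ min c₀ (1 - c₀) / 2 := min_le_right _ _
    have h2 : min c₀ (1 - c₀) ≤ c₀ := min_le_left _ _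
    linarith
  have hδc₁ : δ < 1 - c₀ := by
    have h1 : δ ≤ min c₀ (1 - c₀) / 2 := min_le_right _ _
    have h2 : min c₀ (1 - c₀) ≤ 1 - c₀ := min_le_right _ _
    have h3 : 0 < 1 - c₀ := by linarith
    linarith
  set S : Set ℝ := Icc (c₀ - δ) (c₀ + δ) with hS_def
  have hS0 : ∀ c ∈ S, 0 < c := fun c hc ↦ by linarith [hc.1]
  have hS1 : ∀ c ∈ S, c < 1 := fun c hc ↦ by linarith [hc.2]
  have hgS : ∀ c ∈ S, g c ≤ A + η' := by
    intro c hc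
    have hdist : dist c c₀ < δ₁ := by
      rw [Real.dist_eq, abs_lt]
      constructor <;> linarith [hc.1, hc.2]
    have h := hδ₁g hdist
    rw [Real.dist_eq, abs_lt, hgc₀] at h
    linarith [h.2]
  -- `Φ⁻¹` is `(A + η')`-Lipschitz on `S`
  have hPhiInvS : LipschitzOnWith (Real.toNNReal (A + η')) PhiInv S := by
    refine (convex_Icc _ _).lipschitzOnWith_of_nnnorm_hasDerivWithin_le
      (fun c hc ↦ (hasDerivAt_PhiInv_of_mem (hS0 c hc) (hS1 c hc)).hasDerivWithinAt)
      fun c hc ↦ ?_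
    rw [← NNReal.coe_le_coe, coe_nnnorm, Real.coe_toNNReal _ (by positivity), Real.norm_eq_abs,
      abs_of_nonneg (hg_nonneg c)]
    exact hgS c hc
  -- the datum `v = c₀ + ε ũ` with values in `S`
  set B' : ℝ := max B 1 with hB'_def
  have hB' : 0 < B' := lt_of_lt_of_le one_pos (le_max_right _ _)
  set ε : ℝ := δ / B' with hε_def
  have hε : 0 < ε := div_pos hδ hB'
  have hεB : ε * B' = δ := div_mul_cancel₀ δ hB'.ne'
  set v : 𝒳.Slice s → ℝ := fun z ↦ c₀ + ε * u₀ z with hv_def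
  have hvS : ∀ z, v z ∈ S := by
    intro z
    have h1 : |ε * u₀ z| ≤ δ := by
      rw [abs_mul, abs_of_pos hε, ← hεB]
      exact mul_le_mul_of_nonneg_left ((hB z).trans (le_max_left _ _)) hε.le
    rw [abs_le] at h1
    exact ⟨by show c₀ - δ ≤ c₀ + ε * u₀ z; linarith [h1.1],
      by show c₀ + ε * u₀ z ≤ c₀ + δ; linarith [h1.2]⟩
  have hvm : Measurable v := measurable_const.add (hm.const_mul ε)
  have hv01 : ∀ z, v z ∈ Icc (0 : ℝ) 1 := fun z ↦
    ⟨(hS0 _ (hvS z)).le, (hS1 _ (hvS z)).le⟩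
  have hvlip : ∀ z₁ z₂, dist (v z₁) (v z₂) ≤ ε * L * dist z₁ z₂ := by
    intro z₁ z₂
    have h1 : dist (v z₁) (v z₂) = ε * dist (u₀ z₁) (u₀ z₂) := by
      show dist (c₀ + ε * u₀ z₁) (c₀ + ε * u₀ z₂) = ε * dist (u₀ z₁) (u₀ z₂)
      rw [dist_add_left, Real.dist_eq, Real.dist_eq, ← mul_sub, abs_mul, abs_of_pos hε]
    rw [h1, mul_assoc]
    exact mul_le_mul_of_nonneg_left (hlip z₁ z₂) hε.le
  -- `f = Φ⁻¹ ∘ v` is `K := (A + η') ε L`-Lipschitz and `v = Φ ∘ f`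
  set f : 𝒳.Slice s → ℝ := fun z ↦ PhiInv (v z) with hf_def
  set K : ℝ := (A + η') * (ε * L) with hK_def
  have hK : 0 < K := by positivity
  have hflip : ∀ z₁ z₂, dist (f z₁) (f z₂) ≤ K * dist z₁ z₂ := by
    intro z₁ z₂
    have h1 := hPhiInvS.dist_le_mul _ (hvS z₁) _ (hvS z₂)
    rw [Real.coe_toNNReal _ (by positivity)] at h1
    calc dist (f z₁) (f z₂) ≤ (A + η') * dist (v z₁) (v z₂) := h1
      _ ≤ (A + η') * (ε * L * dist z₁ z₂) :=
          mul_le_mul_of_nonneg_left (hvlip z₁ z₂) (by positivity)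
      _ = K * dist z₁ z₂ := by rw [hK_def]; ring
  have hvf : v = Phi ∘ f := by
    funext z
    show v z = Phi (PhiInv (v z))
    rw [Phi_PhiInv (hS0 _ (hvS z)) (hS1 _ (hvS z))]
  -- the parameter `T = K⁻²`, so that `T^{-1/2} = K`
  set T : ℝ := K⁻¹ ^ 2 with hT_def
  have hT : 0 < T := by positivity
  have hTK : 1 / Real.sqrt T = K := by
    rw [hT_def, Real.sqrt_sq (inv_pos.2 hK).le, one_div, inv_inv]
  have hfT : LipschitzWith (Real.toNNReal (1 / Real.sqrt T)) f := by
    rw [hTK]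
    refine LipschitzWith.of_dist_le_mul fun z₁ z₂ ↦ ?_
    rw [Real.coe_toNNReal _ hK.le]
    exact hflip z₁ z₂
  -- item (6) of the definition of a metric flow, applied to `v`
  have h6 := 𝒳.heatFlowOf_eq_Phi_comp_or_const hst hT.le hvm hv01 fun _ ↦ ⟨f, hfT, hvf⟩
  -- `∫ v dν_{x;s} = c₀ + ε u_t(x)`
  have hint : ∀ z : 𝒳.Slice t, 𝒳.heatFlowOf s v t z = c₀ + ε * 𝒳.heatFlowOf s u₀ t z := by
    intro z
    haveI := 𝒳.isProbabilityMeasure_condKernel z hst.le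
    have hi : Integrable u₀ (𝒳.condKernel z s) := integrable_of_bounded_measurable hm hB
    rw [heatFlowOf_apply, heatFlowOf_apply]
    show ∫ w, c₀ + ε * u₀ w ∂(𝒳.condKernel z s) = c₀ + ε * ∫ w, u₀ w ∂(𝒳.condKernel z s)
    rw [integral_add (integrable_const c₀) (hi.const_mul ε), integral_const, integral_const_mul,
      probReal_univ, one_smul]
  rcases h6 with ⟨c, hc⟩ | ⟨f', hf'lip, hf'⟩
  · -- `u_t` is constant
    have hxy : 𝒳.heatFlowOf s u₀ t x = 𝒳.heatFlowOf s u₀ t y := by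
      have h1 := hc x
      have h2 := hc y
      rw [hint] at h1 h2
      have h3 : ε * 𝒳.heatFlowOf s u₀ t x = ε * 𝒳.heatFlowOf s u₀ t y := by linarith
      exact mul_left_cancel₀ hε.ne' h3
    rw [hxy, dist_self]
    positivity
  · -- `c₀ + ε u_t = Φ ∘ f'` with `f'` `(t - s + T)^{-1/2}`-, hence `K`-Lipschitz
    have hf'K : ∀ z₁ z₂, dist (f' z₁) (f' z₂) ≤ K * dist z₁ z₂ := by
      intro z₁ z₂
      have h1 := hf'lip.dist_le_mul z₁ z₂
      have hle : 1 / Real.sqrt ((t : ℝ) - s + T) ≤ K := by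
        rw [← hTK]
        exact one_div_le_one_div_of_le (Real.sqrt_pos.2 hT)
          (Real.sqrt_le_sqrt (by linarith [hst.le]))
      have hnn : 0 ≤ 1 / Real.sqrt ((t : ℝ) - s + T) := by positivity
      rw [Real.coe_toNNReal _ hnn] at h1
      exact h1.trans (mul_le_mul_of_nonneg_right hle dist_nonneg)
    have hPhi : ∀ a b : ℝ, dist (Phi a) (Phi b) ≤ A⁻¹ * dist a b := by
      intro a b
      have h1 := lipschitzWith_Phi.dist_le_mul a b
      rwa [Real.coe_toNNReal _ (inv_nonneg.2 hA.le)] at h1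
    have hux : ε * 𝒳.heatFlowOf s u₀ t x = Phi (f' x) - c₀ := by
      have h1 := hf' x; rw [hint] at h1; linarith
    have huy : ε * 𝒳.heatFlowOf s u₀ t y = Phi (f' y) - c₀ := by
      have h1 := hf' y; rw [hint] at h1; linarith
    have hkey : ε * dist (𝒳.heatFlowOf s u₀ t x) (𝒳.heatFlowOf s u₀ t y) ≤
        ε * ((L + η) * dist x y) := by
      have h1 : ε * dist (𝒳.heatFlowOf s u₀ t x) (𝒳.heatFlowOf s u₀ t y) =
          dist (Phi (f' x)) (Phi (f' y)) := by
        rw [Real.dist_eq, Real.dist_eq, ← abs_of_pos hε, ← abs_mul, mul_sub, hux, huy]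
        congr 1
        ring
      rw [h1]
      calc dist (Phi (f' x)) (Phi (f' y)) ≤ A⁻¹ * dist (f' x) (f' y) := hPhi _ _
        _ ≤ A⁻¹ * (K * dist x y) := mul_le_mul_of_nonneg_left (hf'K x y) (inv_nonneg.2 hA.le)
        _ = ε * ((L + η) * dist x y) := by
            rw [hK_def, hη'_def]
            field_simp
    exact le_of_mul_le_mul_left hkey hε

/-- **Heat flows preserve Lipschitz bounds** (Bamler 2023, §3.2, gradient-type estimates (b):
*"If `u_s` is `L`-Lipschitz for some `L ≥ 0`, then so is `u_t`"*), for bounded measurable data: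
the heat flow `u_t = ∫ ũ dν_{·;s}` of a bounded measurable `L`-Lipschitz `ũ : 𝒳_s → ℝ` is
`L`-Lipschitz on `𝒳_t` for every `t ≥ s` (`dist_heatFlowOf_le` for every `L' > L` and `η > 0`).
[cite: Bamler2023, §3.2, Proposition (gradient-type estimates) (b)] -/
theorem lipschitzWith_heatFlowOf {s t : I} (hst : (s : ℝ) ≤ t) {u₀ : 𝒳.Slice s → ℝ}
    (hm : Measurable u₀) {B : ℝ} (hB : ∀ y, |u₀ y| ≤ B) {L : ℝ≥0} (hL : LipschitzWith L u₀) :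
    LipschitzWith L (𝒳.heatFlowOf s u₀ t) := by
  rcases hst.eq_or_lt with heq | hlt
  · have hst' : s = t := Subtype.ext heq
    subst hst'
    rw [heatFlowOf_self]
    exact hL
  refine LipschitzWith.of_dist_le_mul fun x y ↦ le_of_forall_pos_le_add fun e he ↦ ?_
  -- `ũ` is also `(L + η)`-Lipschitz, `η = e / (2 (d + 1))`
  set η : ℝ := e / (2 * (dist x y + 1)) with hη_def
  have hd1 : 0 < dist x y + 1 := by positivity
  have hη : 0 < η := by positivity
  have hlip : ∀ y₁ y₂, dist (u₀ y₁) (u₀ y₂) ≤ ((L : ℝ) + η) * dist y₁ y₂ := fun y₁ y₂ ↦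
    (hL.dist_le_mul y₁ y₂).trans (mul_le_mul_of_nonneg_right (by linarith) dist_nonneg)
  have h := 𝒳.dist_heatFlowOf_le hlt hm hB (by positivity) hlip hη x y
  have hηd : 2 * η * dist x y ≤ e := by
    rw [hη_def]
    rw [show 2 * (e / (2 * (dist x y + 1))) * dist x y = e * (dist x y / (dist x y + 1)) by
      field_simp]
    have h1 : dist x y / (dist x y + 1) ≤ 1 := by
      rw [div_le_one hd1]; linarith
    calc e * (dist x y / (dist x y + 1)) ≤ e * 1 := mul_le_mul_of_nonneg_left h1 he.le
      _ = e := mul_one e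
  calc dist (𝒳.heatFlowOf s u₀ t x) (𝒳.heatFlowOf s u₀ t y)
      ≤ ((L : ℝ) + η + η) * dist x y := h
    _ = (L : ℝ) * dist x y + 2 * η * dist x y := by ring
    _ ≤ (L : ℝ) * dist x y + e := by linarith

/-- **Heat flows preserve Lipschitz bounds, for an arbitrary heat flow** (Bamler 2023, §3.2,
gradient-type estimates (b)): if `(u_t)_{t ∈ I'}` is a heat flow over `I'` and `u_s` is bounded,
measurable and `L`-Lipschitz for some `s ∈ I'`, then `u_t` is `L`-Lipschitz for every `t ≥ s` in
`I'` (`u_t = ∫ u_s dν_{·;s}` by the definition of a heat flow).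
[cite: Bamler2023, §3.2, Proposition (gradient-type estimates) (b)] -/
theorem IsHeatFlow.lipschitzWith {I' : Set ℝ} {u : ∀ t : I, 𝒳.Slice t → ℝ}
    (hu : 𝒳.IsHeatFlow I' u) {s t : I} (hs : (s : ℝ) ∈ I') (ht : (t : ℝ) ∈ I')
    (hst : (s : ℝ) ≤ t) (hm : Measurable (u s)) {B : ℝ} (hB : ∀ y, |u s y| ≤ B) {L : ℝ≥0}
    (hL : LipschitzWith L (u s)) : LipschitzWith L (u t) := by
  have heq : u t = 𝒳.heatFlowOf s (u s) t := funext fun x ↦ (hu hs ht hst x).2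
  rw [heq]
  exact 𝒳.lipschitzWith_heatFlowOf hst hm hB hL

end MetricFlow

end Literature.Geometry.Riemannian

end
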